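import Summits.QuantumFields.YangMills.Theorems.ForcedResponseSkewnessResponseLocalisationFarCharged
import HarnessLib

/-!
# Crux `ResponseLocalisation` (stmt-QuantumFields-24293), far stub `Repair.stub_far : FarSigR`:
# the far-field ceiling — hence `FarSigR` — from the femto boundary law `FBL` and volume-uniform clustering

Support file (`--supports stmt-QuantumFields-24293 --as helper`) of the width prover `ym-line-frs-p2` (lead `ym-line-frs-p1`; GO of
2026-08-28T02:26Z), route `ForcedResponseSkewness`.  It documents what discharges the far-field clause that the lead's rev-4 edit moves
from the crux into the declared residual (`FloorWithScalingLimits`): NO registered stub of the line is closed here, and the second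
hypothesis is GAP-CLASS (IR), deliberately NOT a stub of this line (NT ⇐ clustering would be circular against the IR rung).

* `far_ceiling_of_fbl_clustering` — per source `v ⊆ closedBall p ρ ∩ {t > 0}`: from `FBL G r a` (tree def, the spine's femto boundary
  law — UV, engine-grade) and a TORUS CLUSTERING hypothesis (explicit, not a `def`): «∃ m K β₀ Λ₀, ∀ β ≥ β₀, ∀ L with Λ₀ ≤ aβ·L, for bounded
  continuous cylinder observables `P, Q` of `ℤ⁴` read through the periodic lift whose supports are torus-separated by `n` in one
  coordinate, `|E_T[PQ] − E_T P E_T Q| ≤ K‖P‖_∞‖Q‖_∞ e^{−m·aβ·n}`» — for every `η > 0`, `Λ ≥ 1` a radius `D` and thresholds `β₆, Λ₆` with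
  `Σ_{x ∈ box L} 𝟙{D < ‖l·aβ·x‖} |respM_{β,L,l·aβ}(x)| ≤ η` for `β ≥ β₆`, `aβ·L ≥ Λ₆`, `l ∈ [1, Λ]`.  Mechanism («collar first, cluster
  second», the item's evidence note `evidence-24293-far-IR.md`): `…FarCollar` (κ₃ = E_T[h_x h_y h_z], ‖h‖ ≤ 2C₁/R⁴), `…FarCluster`
  (clustering of `Cov_T(h_x, h_y h_z)`), `…FarCharged` (triangle majorant on charged triples, one constant), then the landed far-field
  bookkeeping `…FarSmear.far_sum_abs_smear_le` with the kernel cut off to charged triples and the Riemann sums of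
  `…UniformSmearPrep.exists_latticeSum_abs_le`.
* `farSigR_of_fbl_clustering` — `FarSigR` BY NAME from the two hypotheses along the pinned unit (floor witness ⇒ FBL ∧ clustering).

Honest label: a CONDITIONAL discharge (UV femto law + IR clustering, both unproved hypotheses) of ONE clause of a CONDITIONAL rung line (leaf
R2a `BalabanLadder.NT`); the crux, NT and the Yang–Mills mass gap are NOT proved by any of this.
-/

set_option autoImplicit false

noncomputable section

open MeasureTheory Filter Topology
open scoped SchwartzMap
open Literature.MathematicalPhysics.QuantumFieldTheory Literature.MathematicalPhysics.QuantumLattice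
open Literature.Probability.LatticeModels
open Summit.QuantumFields.YangMills.Cruxes.OSLegsFromFemtoAndGap.DlrCollarTransfer
open Summit.QuantumFields.YangMills.Cruxes.RunningCouplingCeiling.Pointwise
open Summit.QuantumFields.YangMills.Cruxes.ResponseLocalisation.Birth

namespace Summit.QuantumFields.YangMills.Cruxes.ResponseLocalisation.Far

section PerSource

variable (G : Type) [Group G] [TopologicalSpace G] [IsTopologicalGroup G] [CompactSpace G]
  [MeasurableSpace G] [BorelSpace G] (r : LatticeRep G)
/-- **Far-field ceiling of the response profile from `FBL` and torus clustering**, per source.  See the module docstring;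
the clustering hypothesis `hCl` is gap-class and NOT proved; `FBL` is the spine's femto boundary law (unproved engine input). -/
theorem far_ceiling_of_fbl_clustering (a : ℝ → ℝ) (hpos : ∀ β, 0 < a β) (hlim : Tendsto a atTop (nhds 0))
    (hFBL : FBL G r a)
    (hCl : ∃ m K β₀ Λ₀ : ℝ, 0 < m ∧ 0 ≤ K ∧ ∀ β : ℝ, β₀ ≤ β → ∀ L : ℕ, Λ₀ ≤ a β * L →
      ∀ (P Q : LGConfig 4 G → ℝ) (SP SQ : Finset (Literature.MathematicalPhysics.QuantumLattice.ZdEdge 4))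
        (CP CQ : ℝ), Continuous P → Continuous Q → IsCylinder P SP → IsCylinder Q SQ →
        (∀ U, |P U| ≤ CP) → (∀ U, |Q U| ≤ CQ) → ∀ (k : Fin 4) (n : ℕ),
        (∀ e ∈ SP, ∀ e' ∈ SQ, (n : ℤ) ≤ |((((e.1 k - e'.1 k : ℤ) : ZMod (2 * L + 1))).valMinAbs : ℤ)|) →
        |torusE G r β L (fun U => P U * Q U) - torusE G r β L P * torusE G r β L Q| ≤
          K * CP * CQ * Real.exp (-(m * a β * n)))
    (v : 𝓢(EuclideanSpace ℝ (Fin 4), ℝ)) {p : EuclideanSpace ℝ (Fin 4)} {ρ : ℝ}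
    (hball : tsupport (v : EuclideanSpace ℝ (Fin 4) → ℝ) ⊆ Metric.closedBall p ρ)
    (hsupp : tsupport (v : EuclideanSpace ℝ (Fin 4) → ℝ) ⊆ {y : EuclideanSpace ℝ (Fin 4) | 0 < y 0})
    {η : ℝ} (hη : 0 < η) {Λ : ℝ} (hΛ : 1 ≤ Λ) :
    ∃ D : ℝ, 0 < D ∧ ∃ β₆ Λ₆ : ℝ, ∀ β : ℝ, β₆ ≤ β → ∀ L : ℕ, Λ₆ ≤ a β * L → ∀ l : ℝ, l ∈ Set.Icc 1 Λ →
      ∑ x ∈ box 4 L, (if D < ‖(l * a β) • siteToE x‖ then |respM G r β L (l * a β) v x| else 0) ≤ η := by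
  classical
  obtain ⟨C₁, β₁, ℓ₁, pf, hℓ₁, hC₁, hF⟩ := hFBL
  obtain ⟨m, K, β₀, Λ₀, hm, hK, hCl⟩ := hCl
  obtain ⟨g, hg, hv', hθ'⟩ := exists_wall_gap v hball hsupp
  -- radii and the collar scale
  set R₀ : ℝ := max (‖p‖ + ρ) 0 with hR₀
  have hR₀0 : 0 ≤ R₀ := le_max_right _ _
  have hR₀p : ‖p‖ + ρ ≤ R₀ := le_max_left _ _
  clear_value R₀
  set rr : ℝ := min (g / 4) (ℓ₁ / 5) with hrr
  have hrr0 : 0 < rr := lt_min (by positivity) (by positivity)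
  have hrrg : rr ≤ g / 4 := min_le_left _ _
  have hrrℓ : rr ≤ ℓ₁ / 5 := min_le_right _ _
  clear_value rr
  -- the majorant constant of `abs_torusK3_le_triangle_charged`
  set A : ℝ := K * (2 * C₁) ^ 3 * (2 / rr) ^ 12 * Real.exp (m * (R₀ + 2 * rr + 4) / Λ) * (1 + 2 * R₀) ^ 4 *
    ((1 + R₀) ^ 8 * (2 ^ 8 * (1 + 40320 / (m / (2 * Λ)) ^ 8))) with hA
  have hA0 : 0 ≤ A := by positivity
  -- Riemann sums of both sources
  set N : ℝ := (∫ y, |v y|) + 1 with hN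
  have hN0 : 0 < N := by
    have : 0 ≤ ∫ y, |v y| := integral_nonneg fun _ => abs_nonneg _
    rw [hN]; linarith
  have hvR : tsupport (v : EuclideanSpace ℝ (Fin 4) → ℝ) ⊆ Metric.closedBall 0 R₀ := by
    refine hball.trans (Metric.closedBall_subset_closedBall' ?_)
    rw [dist_zero_right]; linarith
  have hθR := Summit.QuantumFields.YangMills.Cruxes.NT.Reference.tsupport_thetaTest_subset_closedBall_zero hvR
  obtain ⟨s₁, hs₁, h₁⟩ := exists_latticeSum_abs_le v hvR
  obtain ⟨s₂, hs₂, h₂⟩ := exists_latticeSum_abs_le (thetaTest 4 v) hθR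
  -- the far radius
  set D : ℝ := max (max 2 (2 * R₀ + 4 * rr + 8)) (2 ^ 14 * A * N ^ 2 / (g ^ 4 * η) + 1) with hD
  have hD2 : 2 ≤ D := le_trans (le_max_left _ _) (le_max_left _ _)
  have hDrr : 2 * R₀ + 4 * rr + 8 ≤ D := le_trans (le_max_right _ _) (le_max_left _ _)
  have hDR : 2 * R₀ + 1 ≤ D := by linarith [hrr0]
  have hDA : 2 ^ 14 * A * N ^ 2 / (g ^ 4 * η) < D := lt_of_lt_of_le (lt_add_one _) (le_max_right _ _)
  have hD0 : 0 < D := by linarith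
  clear_value D
  -- the spacing threshold `s₀` and the coupling / torus thresholds
  set s₀ : ℝ := min (min s₁ s₂) (min 1 (min (rr / 2) (g / 8))) with hs₀
  have hs₀0 : 0 < s₀ := by positivity
  have hΛ0 : 0 < Λ := by linarith
  have hev : ∀ᶠ β in atTop, a β < s₀ / Λ := hlim.eventually (gt_mem_nhds (by positivity))
  obtain ⟨β₂, hβ₂⟩ := Filter.eventually_atTop.mp hev
  refine ⟨D, hD0, max (max β₁ β₀) β₂, max Λ₀ (max (2 * R₀) (4 * rr + 8)), fun β hβ L hL l hl => ?_⟩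
  have hβ1 : β₁ ≤ β := le_trans (le_trans (le_max_left _ _) (le_max_left _ _)) hβ
  have hβ0 : β₀ ≤ β := le_trans (le_trans (le_max_right _ _) (le_max_left _ _)) hβ
  have hβ2' : β₂ ≤ β := le_trans (le_max_right _ _) hβ
  have hLΛ₀ : Λ₀ ≤ a β * L := le_trans (le_max_left _ _) hL
  have hL2R : 2 * R₀ ≤ a β * L := le_trans (le_trans (le_max_left _ _) (le_max_right _ _)) hL
  have hL4r : 4 * rr + 8 ≤ a β * L := le_trans (le_trans (le_max_right _ _) (le_max_right _ _)) hL
  have haβ : 0 < a β := hpos β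
  -- the spacing `s = l · aβ ∈ (0, s₀]`
  set s : ℝ := l * a β with hsdef
  have hs : 0 < s := mul_pos (by linarith [hl.1]) haβ
  have hsaβ : a β ≤ s := by
    have := mul_le_mul_of_nonneg_right hl.1 haβ.le
    rw [hsdef]; linarith
  have hsΛ : s ≤ Λ * a β := by rw [hsdef]; exact mul_le_mul_of_nonneg_right hl.2 haβ.le
  have hss₀ : s ≤ s₀ := by
    have h1 : a β < s₀ / Λ := hβ₂ β hβ2'
    have h2 : Λ * a β ≤ Λ * (s₀ / Λ) := mul_le_mul_of_nonneg_left h1.le hΛ0.le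
    have h3 : Λ * (s₀ / Λ) = s₀ := by field_simp
    linarith
  have hs1 : s ≤ 1 := le_trans hss₀ (le_trans (min_le_right _ _) (min_le_left _ _))
  have hss₁ : s ≤ s₁ := le_trans hss₀ (le_trans (min_le_left _ _) (min_le_left _ _))
  have hss₂ : s ≤ s₂ := le_trans hss₀ (le_trans (min_le_left _ _) (min_le_right _ _))
  have hsrr : s ≤ rr / 2 := le_trans hss₀ (le_trans (min_le_right _ _) (le_trans (min_le_right _ _) (min_le_left _ _)))
  have hsg : s ≤ g / 8 := le_trans hss₀ (le_trans (min_le_right _ _) (le_trans (min_le_right _ _) (min_le_right _ _)))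
  clear_value s₀ s
  have hsL : 2 * R₀ ≤ s * L := by
    have : a β * L ≤ s * L := mul_le_mul_of_nonneg_right hsaβ (Nat.cast_nonneg L)
    linarith
  -- the collar radius `R = ⌊rr/s⌋`
  set R : ℕ := ⌊rr / s⌋₊ with hRdef
  have hRle : (R : ℝ) ≤ rr / s := Nat.floor_le (by positivity)
  have hRge : rr / s - 1 ≤ (R : ℝ) := by
    have := Nat.lt_floor_add_one (rr / s); rw [← hRdef] at this; linarith
  clear_value R
  have hrs2 : 2 ≤ rr / s := by rw [le_div_iff₀ hs]; linarith
  have hR1r : (1 : ℝ) ≤ R := by linarith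
  have hR1 : 1 ≤ R := by exact_mod_cast hR1r
  have hRr : s * R ≤ rr := by
    have h := (le_div_iff₀ hs).mp hRle
    rw [mul_comm] at h
    exact h
  have hrR : rr ≤ 2 * s * R := by
    have h1 : rr / s ≤ 2 * R := by linarith
    rw [div_le_iff₀ hs] at h1
    have e : 2 * (R : ℝ) * s = 2 * s * R := by ring
    linarith
  have hb : ((2 * R + 3 : ℕ) : ℝ) * a β ≤ ℓ₁ := by
    have h1 : ((2 * R + 3 : ℕ) : ℝ) ≤ 5 * R := by
      have : (1 : ℝ) ≤ R := by exact_mod_cast hR1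
      push_cast; linarith
    calc ((2 * R + 3 : ℕ) : ℝ) * a β ≤ 5 * R * a β := mul_le_mul_of_nonneg_right h1 haβ.le
      _ ≤ 5 * R * s := mul_le_mul_of_nonneg_left hsaβ (by positivity)
      _ = 5 * (s * R) := by ring
      _ ≤ 5 * rr := by linarith
      _ ≤ ℓ₁ := by linarith
  have hRL : 4 * R + 8 ≤ L := by
    have h1 : 4 * (R : ℝ) + 8 ≤ L := by
      have h2 : 4 * (R : ℝ) * a β ≤ 4 * rr := by
        calc 4 * (R : ℝ) * a β ≤ 4 * (R : ℝ) * s := by gcongr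
          _ = 4 * (s * R) := by ring
          _ ≤ 4 * rr := by linarith
      have h3 : a β ≤ 1 := hsaβ.trans hs1
      have h4 : (4 * (R : ℝ) + 8) * a β ≤ (L : ℝ) * a β := by
        have e : (4 * (R : ℝ) + 8) * a β = 4 * (R : ℝ) * a β + 8 * a β := by ring
        have hc : a β * L = (L : ℝ) * a β := mul_comm _ _
        rw [e]; linarith
      exact le_of_mul_le_mul_right h4 haβ
    exact_mod_cast h1
  have hRg : s * (2 * R + 4) ≤ g := by
    have e : s * (2 * (R : ℝ) + 4) = 2 * (s * R) + 4 * s := by ring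
    rw [e]; linarith
  -- the kernel cut off to charged triples, and its triangle majorant
  set Kc : Site 4 → Site 4 → Site 4 → ℝ := fun x y z =>
    if D < ‖s • siteToE x‖ ∧ (thetaTest 4 v) (s • siteToE y) ≠ 0 ∧ v (s • siteToE z) ≠ 0 then
      torusK3 G r β L x y z else 0 with hKc
  have hKcb : ∀ x ∈ box 4 L, ∀ y ∈ box 4 L, ∀ z ∈ box 4 L,
      |Kc x y z| ≤ A * (((1 + torusDist L x y) ^ 4)⁻¹ * ((1 + torusDist L x z) ^ 4)⁻¹ *
        ((1 + torusDist L y z) ^ 4)⁻¹) := by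
    intro x hx y _ z _
    simp only [hKc]
    split_ifs with h
    · obtain ⟨hxD, hθy, hvz⟩ := h
      have hy := hθ' _ hθy
      have hz := hv' _ hvz
      exact abs_torusK3_le_triangle_charged G r β hC₁ (hF β hβ1) hR1 hb hRL hm hK (hCl β hβ0 L hLΛ₀)
        hs hs1 hΛ hsΛ hrr0 hrR hRr hR₀0 hRg hDrr hsL hx hxD (hy.1.trans hR₀p) hy.2 (hz.1.trans hR₀p) hz.2
    · rw [abs_zero]
      have := torusDist_nonneg L x y
      have := torusDist_nonneg L x z
      have := torusDist_nonneg L y z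
      positivity
  clear_value A Kc
  have hmain := far_sum_abs_smear_le L hs hs1 (fun w => (thetaTest 4 v) w) (fun w => v w)
    (R₀ := R₀) (g := g) hg (fun w hw => ((hθ' w hw).1).trans hR₀p) (fun w hw => ((hv' w hw).1).trans hR₀p)
    (fun w hw => (hθ' w hw).2) (fun w hw => (hv' w hw).2) hsL Kc hA0 hKcb hD2 hDR
  -- on far sites the charged kernel reproduces `respM`
  have heq : ∀ x ∈ (box 4 L).filter (fun x : Site 4 => D < ‖s • siteToE x‖),
      respM G r β L s v x =
        ∑ y ∈ box 4 L, ∑ z ∈ box 4 L, (thetaTest 4 v) (s • siteToE y) * v (s • siteToE z) * Kc x y z := by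
    intro x hx
    rw [Finset.mem_filter] at hx
    unfold respM
    refine Finset.sum_congr rfl fun y _ => Finset.sum_congr rfl fun z _ => ?_
    by_cases hθy : (thetaTest 4 v) (s • siteToE y) = 0
    · simp only [hθy, zero_mul]
    by_cases hvz : v (s • siteToE z) = 0
    · simp only [hvz, mul_zero, zero_mul]
    simp only [hKc, if_pos (And.intro hx.2 (And.intro hθy hvz))]
  have hSv : s ^ 4 * ∑ z ∈ box 4 L, |v (s • siteToE z)| ≤ N := h₁ s hs hss₁ L (by linarith only [hsL, hR₀0])
  have hSθ : s ^ 4 * ∑ y ∈ box 4 L, |(thetaTest 4 v) (s • siteToE y)| ≤ N := by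
    have := h₂ s hs hss₂ L (by linarith only [hsL, hR₀0])
    rwa [Summit.QuantumFields.YangMills.Cruxes.NT.CeilingPrice.integral_abs_thetaTest] at this
  clear_value N
  have hSθ0 : 0 ≤ s ^ 4 * ∑ y ∈ box 4 L, |(thetaTest 4 v) (s • siteToE y)| :=
    mul_nonneg (pow_nonneg hs.le 4) (Finset.sum_nonneg fun _ _ => abs_nonneg _)
  have hSv0 : 0 ≤ s ^ 4 * ∑ z ∈ box 4 L, |v (s • siteToE z)| :=
    mul_nonneg (pow_nonneg hs.le 4) (Finset.sum_nonneg fun _ _ => abs_nonneg _)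
  have hcoef0 : 0 ≤ 2 ^ 14 * A / (g ^ 4 * D) := by positivity
  rw [← Finset.sum_filter]
  calc ∑ x ∈ (box 4 L).filter (fun x : Site 4 => D < ‖s • siteToE x‖), |respM G r β L s v x|
      = ∑ x ∈ (box 4 L).filter (fun x : Site 4 => D < ‖s • siteToE x‖),
          |∑ y ∈ box 4 L, ∑ z ∈ box 4 L, (thetaTest 4 v) (s • siteToE y) * v (s • siteToE z) * Kc x y z| :=
        Finset.sum_congr rfl fun x hx => by rw [heq x hx]
    _ ≤ 2 ^ 14 * A / (g ^ 4 * D) * (s ^ 4 * ∑ y ∈ box 4 L, |(thetaTest 4 v) (s • siteToE y)|) *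
          (s ^ 4 * ∑ z ∈ box 4 L, |v (s • siteToE z)|) := hmain
    _ ≤ 2 ^ 14 * A / (g ^ 4 * D) * N * N :=
        mul_le_mul (mul_le_mul_of_nonneg_left hSθ hcoef0) hSv hSv0 (mul_nonneg hcoef0 hN0.le)
    _ = 2 ^ 14 * A * N ^ 2 / (g ^ 4 * D) := by ring
    _ ≤ η := by
        have hgD : 0 < g ^ 4 * D := by positivity
        have hgη : 0 < g ^ 4 * η := by positivity
        rw [div_le_iff₀ hgD]
        have h1 : 2 ^ 14 * A * N ^ 2 < D * (g ^ 4 * η) := by rwa [div_lt_iff₀ hgη] at hDA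
        have e : D * (g ^ 4 * η) = η * (g ^ 4 * D) := by ring
        linarith

end PerSource

/-- **`FarSigR` from the femto boundary law and volume-uniform clustering along the pinned unit.**  Hypothesis (NOT proved, NOT a
registered stub): for every compact simple `G`, `r`, unit map `a → 0⁺` carrying a compactly supported positive-time floor witness,
`FBL G r a` (UV, the spine's engine input) AND torus clustering of bounded cylinder observables in physical units, uniformly on tori
`aβ·L ≥ Λ₀` (IR, gap-class).  Conclusion: the registered far-field statement `FarSigR` of line «birth-r» by name (with room: the bound
is `η ≤ η(1+|∂_cQ2|)`). -/
theorem farSigR_of_fbl_clustering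
    (hPhys : ∀ (G : Type) [Group G] [TopologicalSpace G] [IsTopologicalGroup G] [CompactSpace G],
      IsCompactSimpleLieGroup G →
      letI : MeasurableSpace G := borel G
      haveI : BorelSpace G := ⟨rfl⟩
      ∀ (r : LatticeRep G) (a : ℝ → ℝ), (∀ β, 0 < a β) → Filter.Tendsto a Filter.atTop (nhds 0) →
        (∃ (v₀ : 𝓢(EuclideanSpace ℝ (Fin 4), ℝ)) (ε β₅ Λ₅ : ℝ), HasCompactSupport v₀ ∧
          tsupport v₀ ⊆ {y : EuclideanSpace ℝ (Fin 4) | 0 < y 0} ∧ 0 < ε ∧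
          ∀ β : ℝ, β₅ ≤ β → ∀ L : ℕ, Λ₅ ≤ a β * L → ε ≤ Q2 G r β L (a β) (thetaTest 4 v₀) v₀) →
        FBL G r a ∧
        (∃ m K β₀ Λ₀ : ℝ, 0 < m ∧ 0 ≤ K ∧ ∀ β : ℝ, β₀ ≤ β → ∀ L : ℕ, Λ₀ ≤ a β * L →
          ∀ (P Q : LGConfig 4 G → ℝ) (SP SQ : Finset (Literature.MathematicalPhysics.QuantumLattice.ZdEdge 4))
            (CP CQ : ℝ), Continuous P → Continuous Q → IsCylinder P SP → IsCylinder Q SQ →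
            (∀ U, |P U| ≤ CP) → (∀ U, |Q U| ≤ CQ) → ∀ (k : Fin 4) (n : ℕ),
            (∀ e ∈ SP, ∀ e' ∈ SQ, (n : ℤ) ≤ |((((e.1 k - e'.1 k : ℤ) : ZMod (2 * L + 1))).valMinAbs : ℤ)|) →
            |torusE G r β L (fun U => P U * Q U) - torusE G r β L P * torusE G r β L Q| ≤
              K * CP * CQ * Real.exp (-(m * a β * n)))) :
    FarSigR := by
  intro G _ _ _ _ hG
  letI : MeasurableSpace G := borel G
  haveI : BorelSpace G := ⟨rfl⟩
  intro r a hpos hlim p ρ ε hε v hball hsupp _hL1 hfloor η hη Λ hΛ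
  obtain ⟨β₅, Λ₅, hfl⟩ := hfloor
  have hcpt : HasCompactSupport (v : EuclideanSpace ℝ (Fin 4) → ℝ) :=
    (isCompact_closedBall p ρ).of_isClosed_subset (isClosed_tsupport _) hball
  obtain ⟨hFBL, hCl⟩ := hPhys G hG r a hpos hlim ⟨v, ε, β₅, Λ₅, hcpt, hsupp, hε, hfl⟩
  obtain ⟨D, hD, β₆, Λ₆, hfar⟩ := far_ceiling_of_fbl_clustering G r a hpos hlim hFBL hCl v hball hsupp hη hΛ
  refine ⟨D, hD, β₆, Λ₆, fun β hβ L hL l hl => (hfar β hβ L hL l hl).trans ?_⟩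
  exact le_mul_of_one_le_right hη.le
    (by linarith [abs_nonneg (deriv (fun c : ℝ => Q2 G r c L (l * a β) (thetaTest 4 v) v) β)])

end Summit.QuantumFields.YangMills.Cruxes.ResponseLocalisation.Far

end
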